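import Literature.MathematicalPhysics.QuantumFieldTheory.Balaban1983to89.B8Thm2TorusAt
import Literature.MathematicalPhysics.QuantumFieldTheory.Balaban1983to89.B10Eq68TorusRegularity

/-!
# `Balaban1983to89.B8Thm2SetupTorus` — T. Bałaban, *Spaces of regular gauge field configurations on a lattice and gauge fixing
# conditions*, Commun. Math. Phys. **99** (1985) 75–102 [Balaban1985RegularSpaces] ("B8"), **Theorem 2** (p. 83) FOR THE DOMAIN
# SEQUENCE `Ω_j = T_η` READ AT THE SETUP-TORUS OBJECTS (`Setup.Params P`, the finest lattice `Site P 0`, configurations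
# `GaugeField P 0 U(N)` ∕ `GaugeField P 0 SU(N)`, gauge transformations `GaugeTransf P 0 …`) — THE JUNCTION between the periodic-`ℤᵈ`
# hypothesis schema `B8Thm2TorusAt.Thm2TorusAt` (carriers of the pub-ymgap DAG nodes N05 ∕ N16) and the torus carriers of the LQB ∕ T³
# lanes (`B10Eq68TorusRegularity.InSpace`, `T3SectALandauChart`), through the periodic pullback `B10Eq27TorusAxialLog.pull`

statement-level skeleton of published theorems with citation tags; proofs where landed; nothing here is a claim about the Yang–Mills mass gap

PDF held: `paper:balaban1985-cmp99-regular-spaces-gauge-fixing` (journal page = PDF page + 74), pp. 76–77, 82–83 [PDF 2–3, 8–9] read (text layer;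
p. 82 on the x2 render `run/shared/lean/pub/pub-balaban/b2b-balaban-ref1/pages/1985-cmp99-regular-spaces-gauge-fixing/…-p008-x2.png`);
[Balaban1985Averaging] = `paper:balaban1985-cmp98-averaging`, pp. 17–18 [PDF 1–2] read (text layer).

WHY (mega-formalisation `lit-balaban`, director-ym R141 (B) typer seat `lit-balaban-type-B8` gen 2, second module; consumers of record: the
ym3 cell's stmt-QuantumFields-19200 leaf V3 «GAUGE CHART» (GO on the ym-fleet bus 2026-08-26T17:44Z), the K1 statement stmt-QuantumFields-19674,
DAG nodes N05 ∕ N16).  `B8Thm2TorusAt` (p465891) types Theorem 2 for `Ω_j = T_η` on the N05 ∕ N16 carrier: `ℤᵈ` configurations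
`LSite d → Fin d → 𝔸ˣ` PERIODIC under `B12Ineq417Flat.shiftCfg (P • e i)`, gauge group `G : Subgroup 𝔸ˣ`.  The LQB lane (`B10Eq…Torus…`,
`B15…`) and the T³ lane (`T3Thm1Carrier`, `T3PrintedRegularMinimiser`, and the T³-NATIVE presentation of [B11] Sect. A + Prop. 2 with SLOTS for
the [B8] letters, `T3SectALandauChart.Resid` ∕ `Prop2NativeAt`, seat `lit-balaban-type-B11` gen 2, which cites `Thm2TorusAt` ∕ `Concl2T` for
the bodies) hold their configurations as `Setup.GaugeField P 0 (Matrix.unitaryGroup (Fin N) ℂ)` ∕ `… (Matrix.specialUnitaryGroup (Fin N) ℂ)`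
on the torus `Site P 0 = (ZMod (sitesPerDir 0))^d` and read `ℤᵈ` statements through `pull` (base point `0`).  By the DIVISION WORD of the two
typer seats (pub-ymgap bus 2026-08-26T20:16Z) the native T³ letters are type-B11's and THIS file is the junction promised in `B8Thm2TorusAt` §6:
the dictionary by which a holder of `Thm2TorusAt` (or of its uniform form) at the period `sitesPerDir 0` READS Theorem 2 at the Setup objects —
hypotheses stated on torus configurations (`InSpace`, and the (1.34)₂ ∕ (1.29) ∕ (1.35) letters of record on the pullbacks), conclusion with a
TORUS one-form `A` and uniqueness among TORUS gauge transformations (`U(N)`-valued with values in `G`, or `SU(N)`-valued natively) — with no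
third vocabulary: every letter is a letter of record composed with `pull`.

THE PRINTED TEXT (verbatim; the displays (1.33)–(1.39), (1.29) are quoted in full in the module docstring of `B8Thm2TorusAt`).  p. 83 [PDF 9]:
«Theorem 2. There exist constants B₁, B₂(β₀), c₁ such that for arbitrary U₀, U′U₀ satisfying (1.33)–(1.35) with α₀ + α₁ ≦ c₁ there exists
exactly one gauge transformation u satisfying (1.29) and such that the conditions (1.36)–(1.39) hold for the configuration U₁ = U′^{u⁻¹}.»
p. 77 [PDF 3]: «We consider a sequence of domains … Ω₀ ⊃ Ω₁ ⊃ Ω₂ ⊃ … ⊃ Ω_k, Ω_j ⊂ T_η, j = 0, 1, …, k, (1.3) which satisfy the following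
conditions: Ω_j = Bʲ(Ω_j^{(j)}), Ω_j is a sum of cubes of a size M₁Lʲη … (1.4)»; «Let us notice that we admit the case where some domains Ω_j
are equal to T_η, for example Ω_j = T_η for j = 0,1,…,l, l ≤ k.»; «for a sequence (1.3) and a positive number α₀ we define 𝔄_k({Ω_j}, α₀) as a
set of all gauge field configurations U on T_η satisfying the conditions |U(∂p) − 1| < α₀L^{−2j} for p ∈ Ω_j, j = 0,1,…,k, (1.7) … (1.9)».
[Balaban1985Averaging] (4) p. 18 [PDF 2]: «We assume that Bʲ(Ω^{(j)}) = Ω for j = 1, …, k (4) for some k. … Thus Ω is a sum of blocks of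
the order k.»

WHAT THIS FILE TYPES ∕ PROVES (kernel; std axioms; every theorem proved; the `def`s are dictionary entries and hypothesis SHAPES with bodies,
asserted for nothing).  Throughout `P : Params`, torus sites `Site P j`, `ℤᵈ` sites `LSite P.d` (= `B7Prop1Explicit.Site`), `transl y z = y + z`,
`pull V y z μ = V ⟨y + z, μ⟩`, `rel y x` = the centred representative of `x − y` (`B10Eq27TorusAxialLog`).
* §1 THE PERIODIC PULLBACK: `transl_add_period` (`y + (z + n·e_i) = y + z`, `n = sitesPerDir j`), **`pull_periodic`** (the pullback of a torus
  configuration is `shiftCfg (n • e i)`-periodic — the periodicity binder of `Thm2TorusAt`), `pullGauge u y z := u (y + z)` (+ `_apply`,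
  `_periodic`), `pull_gaugeActT_eq`, `descendGauge u y x := u (rel y x)` (+ `_apply`), `descendGauge_pullGauge`, the private helper
  `periodic_smul_of_periodic` (periodic in every `e_i` ⇒ periodic under `n·ℤᵈ`), **`pullGauge_descendGauge`** (an `n`-periodic `ℤᵈ` gauge transformation IS the pullback of
  its descent).
* §2 [B8] (1.7) + (1.9) ON THE TORUS = THE `ℤᵈ` LINEAGE'S CLASS OF THE PULLBACK: `pullSet X y := {z | y + z ∈ X}`, `pullDom Ω j := pullSet (Ω j) 0`,
  `pullDom_univ`; the touching predicates commute with `pull` (`plaqTouches_pullSet_iff(_swap)`, `bondTouches_pullSet_iff`); the plaquette and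
  divergence clauses commute with `pull` (`plaq_pull_of_regPlaqAt` — the `ν < μ` orientations of the `ℤᵈ` class through `‖W⁻¹ − 1‖ ≤ ‖W − 1‖`
  for `U1`-valued fields, `B7Prop1Explicit.norm_inv_sub_one_le` —, `regPlaqAt_of_plaq_pull`, `regDivAt_iff_div_pull`); **`inSpaceA_iff_inAk_pull`**: for a GENERAL domain sequence `{Ω_j}`
  and `U1`-valued `V`, `B10Eq68TorusRegularity.InSpaceA k Ω ε₀ η V ↔ B8Ineq132.InAk P.L k η ε₀ (pullDom Ω) (pull V 0)`; for the cell's `U(N)`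
  **`inSpace_iff_inAk_pull`** (`InSpace k Ω ε₀ η U ↔ InAk … (pullDom Ω) (pull (unitsField U) 0)`) and the all-torus case `inSpace_univ_iff_inAk_pull`
  (the (1.33)₁ ∕ (1.34)₁ binder of `Thm2TorusAt`).
* §3 DESCENT AND THE LETTERS AT THE SETUP OBJECTS (`U(N)`): `descendCfg W y` (+ `_apply`, `descendCfg_pull`, `pull_descendCfg`: an `n`-periodic `ℤᵈ`
  configuration is the pullback of its descent); `cfgPull P U := pull (unitsField U) 0`, `gaugePull P u := (Unitary.toUnits ∘ u)♯₀` with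
  `_apply ∕ _mem ∕ _periodic`, `cfgPull_mul`, **`gaugePull_injective`**, **`exists_gaugePull_eq`** (a periodic unitary-valued `ℤᵈ` gauge
  transformation is `gaugePull` of a torus one), `exists_pull_eq_form` (a periodic `ℤᵈ` one-form is the pullback of a torus one-form); the letters
  **`InAxT P k U₀ U`** := `B8Eq119TwistedAxial.InAx P.L k (torusLam k) (cfgPull P U₀) (cfgPull P U)` ((1.34)₂), **`Restr129T P k U₀ u`** :=
  `Restr129 P.L k (torusLam k) (cfgPull P U₀) (gaugePull P u)` ((1.29)), **`Hyp135T P k α₁ U₀ U′`** := `B8Eq133Hypotheses.Hyp135 P.L k (torusLam k) α₁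
  (cfgPull P U₀) (cfgPull P U′)` ((1.35)), **`Concl2Setup P k η β₀ B₁ B₂ len α₀ α₁ U₀ U′ u`** := «∃ A : GaugeField P 0 M_N(ℂ) — a TORUS one-form —
  bondwise self-adjoint, with `mgauge U₀♯ (u♯)⁻¹ U′♯ = cfgExp η A♯` (U₁ = U′^{u⁻¹} = e^{iηA}) ∧ `C136T` ∧ `C137T` ∧ `IsLandau138 … univ (torusLam k)`
  ∧ `C139T` of `B8Thm2TorusAt` for `A♯`, `U₀♯`» ((1.36)–(1.39), readings of record); **`concl2Setup_iff`**: `Concl2Setup … u ↔ B8Thm2TorusAt.Concl2T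
  P.L k (sitesPerDir 0) … (cfgPull P U₀) (cfgPull P U′) (gaugePull P u)`.
* §4 **`Thm2SetupAt P N k η β₀ B₁ B₂ c₁ len G Reg`** — THE INTERFACE AT THE SETUP OBJECTS (`G : Subgroup (M_N(ℂ))ˣ`; `U₀`, `U′ : GaugeField P 0
  U(N)` with `G`-valued bond variables): for `α₀, α₁ > 0`, `α₀ + α₁ ≤ c₁`: (1.33) = `InSpace k {T_η} α₀ η U₀ ∧ Reg (cfgPull P U₀)` [«(3.35) of
  [4]» ABSTRACT, as in `Thm2TorusAt` ∕ `Thm4TorusAt`]; (1.34) = `InSpace … (U′U₀) ∧ InAxT P k U₀ (U′U₀)`; (1.35) = `Hyp135T P k α₁ U₀ U′`;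
  CONCLUSION: a `G`-valued `u : GaugeTransf P 0 U(N)` with `Restr129T ∧ Concl2Setup`, UNIQUE among such.  **`thm2SetupAt_of_thm2TorusAt`** (THE
  JUNCTION): for `G ≤ unitaryUnits M_N(ℂ)`, `Thm2TorusAt P.L k (sitesPerDir 0) η β₀ B₁ B₂ c₁ len G Reg → Thm2SetupAt P N k η β₀ B₁ B₂ c₁ len G Reg`
  (torus data pull back to periodic data in `𝔄_k`; the periodic `ℤᵈ` gauge transformation descends; uniqueness on the torus from uniqueness among
  periodic `ℤᵈ` gauges); `thm2SetupAt_of_uniform` (from `Thm2TorusUniform`: one triple `(B₁, B₂, c₁)` for all `k ≥ 1`, `η > 0`);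
  `thm2SetupAt_unitary_apply` (`G = U(N)`: the value clauses are automatic); `thm2SetupAt_specialUnitary_of_thm2TorusAt` (`G = specialUnitaryUnits (Fin N)`).
* §5 THE `SU(N)`-NATIVE FORM: `toUGauge P N u := suIncl ∘ u` (+ `_apply`, `_injective`, `toUnits_toUGauge_mem`, `unitsField_toUField_mem`,
  `exists_toUGauge_eq`, `toUField_mul`); **`Thm2SetupSUAt P N k η β₀ B₁ B₂ c₁ len Reg`** — `U₀`, `U′ : GaugeField P 0 SU(N)`, the gauge
  transformation ranging over `GaugeTransf P 0 SU(N)` and UNIQUE THERE, every letter read through `toUField` ∕ `toUGauge` (the T³ lane's reading);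
  `thm2SetupSUAt_of_thm2SetupAt`, **`thm2SetupSUAt_of_thm2TorusAt`**.
* §6 NON-VACUITY: `hypotheses_of_one_right_setup` (for ANY `U₀` the perturbation `U′ = 1` satisfies (1.34)₂ and (1.35) at the Setup objects).
* §7 THE GUARDED UNIFORM FORM (referee remark R2 of dag-ref-A on `B8Thm2TorusAt.Thm2TorusUniform`, 2026-08-26: that form quantifies over every
  period `P : ℤ`, and at `P = 0` periodicity is vacuous, so it also speaks of the whole of `ℤᵈ`, which print does not): **`Thm2TorusUniformGuarded
  L β₀ len G Reg`** adds `0 < P` and `(L : ℤ)^k ∣ P` (print's torus is a union of `Lᵏ`-cubes, (1.4) ∕ [B7] (4)); `guarded_of_uniform`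
  (`Thm2TorusUniform → Thm2TorusUniformGuarded`); `period_pos` (`0 < sitesPerDir j`), `pow_dvd_period` (`Lᵏ ∣ sitesPerDir j` for `k ≤ m + K − j`);
  **`thm2SetupAt_of_uniformGuarded`** (the guarded form suffices at the Setup objects for `1 ≤ k ≤ m + K`).  At the Setup objects the period
  `sitesPerDir 0 = 2·L^{m+K}` is positive, so the degenerate case of R2 never arises in §4–§5.

HONEST SCOPE ∕ DECLARED READINGS.  (i) A DICTIONARY and an INTERFACE: Theorem 2 is NOT proved here or anywhere in the tree at a curved background;
`Thm2SetupAt` ∕ `Thm2SetupSUAt` are DERIVED from `Thm2TorusAt` (one direction; the converse — every periodic `ℤᵈ` datum descends, `descendCfg` —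
is not needed and not stated).  (ii) ONE `Params P`, the level-`0` lattice `Site P 0` with `k` averaging levels, the same period `sitesPerDir 0 =
2·L^{m+K}` in every direction (print's `T_η` may have this shape; nothing finer is claimed); the T³ FAMILY bookkeeping of `T3Thm1Carrier`
(`Site (F.P K) (K − n)` versus `Site (F.P n) 0`, the tilt ∕ descent `T3TiltDescent`) is NOT done here — a consumer at those carriers applies this
file at `P := F.P K` (level `0`) and does its own identification.  (iii) Readings = those of `B8Thm2TorusAt` (hence of `B8LeafModelZd3.zdGF3` at
`Ω_j = univ`) verbatim on the pullbacks: (1.37) is the BOUND `|Q_k(U₀, ηA)| < 2dLα₁` only (print's identity «Q_j(U₀, ηA) = B» is not displayed,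
as declared there); (1.38) multiplier form; «(3.35) of [4]» the abstract `Reg`, read on `cfgPull P U₀`; `G`-valuedness of a `U(N)` configuration =
its bond variables read in `(M_N(ℂ))ˣ` lie in `G`.  (iv) The slots of `T3SectALandauChart.Resid` (`IsAxial`, `Restricted`, `AvgCond`, `IsLandau`)
are NOT filled by this file (they live at the T³ carrier, `SU(2)`, `P := F.P K`); the intended one-liners are `IsAxial U₀ U := InAxT (F.P K) k
(toUField U₀) (toUField U)`, `Restricted U₀ u := Restr129T (F.P K) k (toUField U₀) (toUGauge _ _ u)`, `IsLandau` ∕ `AvgCond` from the conjuncts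
of `Concl2Setup` — the consumer's choice, not asserted here.  (v) HAZARDS of record (boundary-layer refutations of `B8.Thm2Printed`, the Theorem-8
`|f|₍₋₂₎` gaps G-B8-13) do not concern this all-torus, source-free geometry (see `B8Thm2TorusAt` (v)).  Count-neutral; nothing continuum ∕ ℝ⁴ ∕ OS ∕
mass-gap ∕ Clay.
-/

noncomputable section

open scoped BigOperators

namespace Literature.MathematicalPhysics.QuantumFieldTheory.Balaban1983to89.B8Thm2SetupTorus

open B7Prop1Explicit renaming Site → LSite
open B7Prop1Explicit (e hol plaqWord U1)
open B7Prop2Explicit (unitaryUnits mem_unitaryUnits unitaryUnits_le_U1 hol_mem_of avgIter)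
open B8Ineq132 (plaqF covDeriv covDiv InAk CondAt PlaqTouches BondTouches)
open B8Eq119TwistedAxial (InAx Restr129)
open B12Ineq417Flat (shiftCfg)
open B10Eq27TorusAxialLog (transl transl_apply transl_zero transl_add transl_add_e transl_sub_e pull pull_apply gaugeActT
  gaugeActT_apply hol_pull hol_pull_zero pull_gaugeActT rel rel_apply transl_rel holT holT_plaqWord_swap unitsField val_unitsField
  unitsField_mem_unitaryUnits toUField)
open B10Eq68TorusRegularity (plaqFT covDivT plaqF_pull covDiv_pull RegPlaqAt RegDivAt InSpaceA InSpace Touches BTouches)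
open B8Thm4TorusAt (torusLam)
open B8Thm2TorusAt (Concl2T Thm2TorusAt)
open B8Eq133Hypotheses (Hyp135)

variable {P : Params} {j : ℕ}

/-! ## §1 The periodic pullback: periods, sections, gauge transformations, descent -/

section Pullback

/-- **Translating by a full period does nothing**: `y + (z + n·e_i) = y + z` on `T^{(j)}`, `n = sitesPerDir j` the number of sites per direction
(bookkeeping of the torus of [Balaban1987RG1] (0.1), no content of the series). [cite: Balaban1987RG1, (0.1) p.251] -/
theorem transl_add_period (y : Site P j) (z : LSite P.d) (i : Fin P.d) :
    transl y (z + ((P.sitesPerDir j : ℕ) : ℤ) • e i) = transl y z := by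
  funext ν
  rw [transl_apply, transl_apply, Pi.add_apply, Pi.smul_apply, B7Prop1Explicit.e_apply]
  by_cases h : ν = i
  · subst h
    simp
  · simp [h]

variable {G : Type*}

/-- **The pullback of a torus configuration is periodic** with period `n = sitesPerDir j` in every direction (the lineage's periodicity letter
`B12Ineq417Flat.shiftCfg (n • e_i) U = U` of `B8Thm4TorusAt.Thm4TorusAt` ∕ `B8Thm2TorusAt.Thm2TorusAt`). [cite: Balaban1985RegularSpaces, (1.3) p.77, p.77 («Ω_j = T_η»)] -/
theorem pull_periodic (V : GaugeField P j G) (y : Site P j) (i : Fin P.d) :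
    shiftCfg (((P.sitesPerDir j : ℕ) : ℤ) • e i) (pull V y) = pull V y := by
  funext z μ
  rw [B12Ineq417Flat.shiftCfg_apply, pull_apply, pull_apply, transl_add_period]

/-- **The pullback of a torus gauge transformation, based at `y`**: `u♯_y(z) := u(y + z)` (the gauge transformation by which
`B10Eq27TorusAxialLog.pull_gaugeActT` reads the torus gauge action on the pullback). [cite: Balaban1985Averaging, (8) p.19] -/
def pullGauge (u : GaugeTransf P j G) (y : Site P j) : LSite P.d → G := fun z => u (transl y z)

/-- Unfolding `pullGauge`. [cite: Balaban1985Averaging, (8) p.19] -/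
theorem pullGauge_apply (u : GaugeTransf P j G) (y : Site P j) (z : LSite P.d) : pullGauge u y z = u (transl y z) := rfl

/-- The pulled-back gauge transformation is periodic. [cite: Balaban1985RegularSpaces, (1.3) p.77] -/
theorem pullGauge_periodic (u : GaugeTransf P j G) (y : Site P j) (z : LSite P.d) (i : Fin P.d) :
    pullGauge u y (z + ((P.sitesPerDir j : ℕ) : ℤ) • e i) = pullGauge u y z := by
  rw [pullGauge_apply, pullGauge_apply, transl_add_period]

/-- `(V^u)♯_y = (V♯_y)^{u♯_y}` — `B10Eq27TorusAxialLog.pull_gaugeActT` in the letter `pullGauge`. [cite: Balaban1985Averaging, (8) p.19] -/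
theorem pull_gaugeActT_eq [Group G] (u : GaugeTransf P j G) (V : GaugeField P j G) (y : Site P j) :
    pull (gaugeActT u V) y = B7Prop1Explicit.gaugeAct (pullGauge u y) (pull V y) :=
  pull_gaugeActT u V y

/-- **DESCENT of a `ℤᵈ` gauge transformation to the torus, based at `y`**: `(u♭_y)(x) := u(x − y)` with `x − y ∈ ℤᵈ` the representative of least
absolute value (`B10Eq27TorusAxialLog.rel`); for an `n`-PERIODIC `u` this inverts `pullGauge` (`pullGauge_descendGauge`). [cite: Balaban1985RegularSpaces, (1.3) p.77] -/
def descendGauge (u : LSite P.d → G) (y : Site P j) : GaugeTransf P j G := fun x => u (rel y x)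

/-- Unfolding `descendGauge`. [cite: Balaban1985RegularSpaces, (1.3) p.77] -/
theorem descendGauge_apply (u : LSite P.d → G) (y x : Site P j) : descendGauge u y x = u (rel y x) := rfl

/-- Descending the pullback gives back the torus gauge transformation (`y + (x − y) = x`). [cite: Balaban1985RegularSpaces, (1.3) p.77] -/
theorem descendGauge_pullGauge (u : GaugeTransf P j G) (y : Site P j) : descendGauge (pullGauge u y) y = u := by
  funext x
  rw [descendGauge_apply, pullGauge_apply, transl_rel]

/-- A function on `ℤᵈ` periodic under `x ↦ x + n·e_i` for every `i` is periodic under every vector of `n·ℤᵈ`. [folklore] -/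
private theorem periodic_smul_of_periodic {β : Type*} {n : ℤ} {u : LSite P.d → β} (hu : ∀ (x : LSite P.d) (i : Fin P.d), u (x + n • e i) = u x)
    (x w : LSite P.d) : u (x + n • w) = u x := by
  classical
  -- one direction at a time, any integer multiple
  have hdir : ∀ (x : LSite P.d) (i : Fin P.d) (t : ℤ), u (x + (n * t) • e i) = u x := by
    intro x i t
    induction t using Int.induction_on generalizing x with
    | zero => simp
    | succ k ih =>
        have : x + (n * ((k : ℤ) + 1)) • e i = (x + (n * (k : ℤ)) • e i) + n • e i := by
          rw [mul_add, mul_one, add_smul, add_assoc]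
        rw [this, hu, ih]
    | pred k ih =>
        have h1 : x + (n * (-(k : ℤ) - 1)) • e i + n • e i = x + (n * (-(k : ℤ))) • e i := by
          rw [add_assoc, ← add_smul]; congr 2; ring
        have := hu (x + (n * (-(k : ℤ) - 1)) • e i) i
        rw [h1, ih] at this
        exact this.symm
  -- decompose `w = Σ_i w_i e_i`
  have hw : n • w = ∑ i : Fin P.d, (n * w i) • e i := by
    funext ν
    simp [Finset.sum_apply, Pi.smul_apply, B7Prop1Explicit.e_apply]
  rw [hw]
  -- add the directions one by one
  suffices h : ∀ (s : Finset (Fin P.d)) (x : LSite P.d), u (x + ∑ i ∈ s, (n * w i) • e i) = u x from h _ x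
  intro s
  induction s using Finset.induction_on with
  | empty => intro x; simp
  | insert i s hi ih =>
      intro x
      rw [Finset.sum_insert hi, add_comm ((n * w i) • e i), ← add_assoc, hdir, ih]

/-- **An `n`-periodic `ℤᵈ` gauge transformation IS the pullback of its descent** (`n = sitesPerDir j`): `(u♭_y)♯_y = u` — the relative
position `(y + z) − y` differs from `z` by a vector of `n·ℤᵈ`. [cite: Balaban1985RegularSpaces, (1.3) p.77] -/
theorem pullGauge_descendGauge {u : LSite P.d → G} (y : Site P j)
    (hu : ∀ (x : LSite P.d) (i : Fin P.d), u (x + ((P.sitesPerDir j : ℕ) : ℤ) • e i) = u x) :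
    pullGauge (descendGauge u y) y = u := by
  funext z
  rw [pullGauge_apply, descendGauge_apply]
  -- `rel y (transl y z) = z + n • t` for an integer vector `t`
  have hdiff : ∀ ν, ∃ t : ℤ, rel y (transl y z) ν = z ν + ((P.sitesPerDir j : ℕ) : ℤ) * t := by
    intro ν
    have hcast : ((rel y (transl y z) ν : ℤ) : ZMod (P.sitesPerDir j)) = ((z ν : ℤ) : ZMod (P.sitesPerDir j)) := by
      rw [rel_apply, transl_apply, add_sub_cancel_left, ZMod.coe_valMinAbs]
    obtain ⟨t, ht⟩ := (ZMod.intCast_eq_intCast_iff_dvd_sub _ _ _).1 hcast.symm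
    exact ⟨t, by linarith⟩
  choose t ht using hdiff
  have hrel : rel y (transl y z) = z + (((P.sitesPerDir j : ℕ) : ℤ)) • (fun ν => t ν) := by
    funext ν; simp [ht ν]
  rw [hrel, periodic_smul_of_periodic hu]

end Pullback

/-! ## §2 [B8] (1.7) + (1.9) «U ∈ 𝔄_k({Ω_j}, α₀)»: the LQB lane's torus class `InSpaceA` ∕ `InSpace` IS the `ℤᵈ` lineage's `InAk` of the pullback -/

section RegularityClass

/-- The region of `ℤᵈ` over a torus region `X ⊂ T^{(j)}`, read from the base point `y`: `{z | y + z ∈ X}` (periodic).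
[cite: Balaban1985RegularSpaces, (1.3) p.77] -/
def pullSet (X : Set (Site P j)) (y : Site P j) : Set (LSite P.d) := {z | transl y z ∈ X}

/-- Membership in `pullSet`. [cite: Balaban1985RegularSpaces, (1.3) p.77] -/
@[simp] theorem mem_pullSet (X : Set (Site P j)) (y : Site P j) (z : LSite P.d) : z ∈ pullSet X y ↔ transl y z ∈ X := Iff.rfl

/-- The domain sequence `{Ω_j}` of the torus read on `ℤᵈ` from the origin. [cite: Balaban1985RegularSpaces, (1.3) p.77] -/
def pullDom (Ω : ℕ → Set (Site P 0)) : ℕ → Set (LSite P.d) := fun j => pullSet (Ω j) 0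

/-- `{Ω_j = T_η}` pulls back to `{ℤᵈ}` (the all-torus geometry of `B8Thm4TorusAt` ∕ `B8Thm2TorusAt`). [cite: Balaban1985RegularSpaces, p.77 («Ω_j = T_η for j = 0,1,…,l, l ≤ k»)] -/
@[simp] theorem pullDom_univ : pullDom (P := P) (fun _ => (Set.univ : Set (Site P 0))) = fun _ => Set.univ := by
  funext j; ext z; simp [pullDom]

/-- Lattice steps on the torus commute: `(x + e_μ) + e_ν = (x + e_ν) + e_μ`. [folklore] -/
private theorem shift_comm' (x : Site P j) (μ ν : Fin P.d) : (x.shift μ).shift ν = (x.shift ν).shift μ := by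
  funext κ
  by_cases hκν : κ = ν
  · subst hκν
    by_cases hκμ : κ = μ
    · subst hκμ; rfl
    · simp [Site.shift, Function.update_apply, hκμ]
  · by_cases hκμ : κ = μ
    · subst hκμ
      simp [Site.shift, Function.update_apply, hκν]
    · simp [Site.shift, Function.update_apply, hκν, hκμ]

variable {𝔸 : Type*} [NormedRing 𝔸] [NormOneClass 𝔸] [NormedAlgebra ℂ 𝔸]

/-- The p. 77 plaquette convention transports: the plaquette `p_{μν}(z)` of `ℤᵈ` touches the pulled-back region iff the torus plaquette at
`y + z` touches the region (all four corners correspond under `transl`, `transl_add_e`). [cite: Balaban1985RegularSpaces, p.77 (convention before (1.5))] -/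
theorem plaqTouches_pullSet_iff (X : Set (Site P 0)) (z : LSite P.d) {μ ν : Fin P.d} (h : μ < ν) :
    PlaqTouches (pullSet X 0) z μ ν ↔ Touches X ⟨transl 0 z, μ, ν, h⟩ := by
  simp only [PlaqTouches, mem_pullSet, Touches, transl_add_e]

/-- The same for the plaquette read with its directions exchanged (`z + e_ν + e_μ = z + e_μ + e_ν`). [cite: Balaban1985RegularSpaces, p.77 (convention before (1.5))] -/
theorem plaqTouches_pullSet_iff_swap (X : Set (Site P 0)) (z : LSite P.d) {μ ν : Fin P.d} (h : ν < μ) :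
    PlaqTouches (pullSet X 0) z μ ν ↔ Touches X ⟨transl 0 z, ν, μ, h⟩ := by
  simp only [PlaqTouches, mem_pullSet, Touches, transl_add_e]
  constructor
  · rintro (h1 | h2 | h3 | h4)
    · exact Or.inl h1
    · exact Or.inr (Or.inr (Or.inl h2))
    · exact Or.inr (Or.inl h3)
    · rw [shift_comm'] at h4
      exact Or.inr (Or.inr (Or.inr h4))
  · rintro (h1 | h2 | h3 | h4)
    · exact Or.inl h1
    · exact Or.inr (Or.inr (Or.inl h2))
    · exact Or.inr (Or.inl h3)
    · rw [shift_comm'] at h4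
      exact Or.inr (Or.inr (Or.inr h4))

/-- The p. 77 bond convention transports: `⟨z, z + e_μ⟩` touches the pulled-back region iff the torus bond `⟨y + z, μ⟩` touches the region.
[cite: Balaban1985RegularSpaces, p.77 (convention before (1.5))] -/
theorem bondTouches_pullSet_iff (X : Set (Site P 0)) (z : LSite P.d) (μ : Fin P.d) :
    BondTouches (pullSet X 0) z μ ↔ BTouches X ⟨transl 0 z, μ⟩ := by
  simp only [BondTouches, mem_pullSet, BTouches, PBond.tgt, transl_add_e]

omit [NormedAlgebra ℂ 𝔸] in
/-- **(1.7) ON THE TORUS ⇒ (1.7) FOR THE PULLBACK, BOTH ORIENTATIONS** (for configurations with values in `{|u| ≤ 1, |u⁻¹| ≤ 1}`: the reversed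
plaquette has the inverse holonomy, `B10Eq27TorusAxialLog.holT_plaqWord_swap`, whose distance to `1` is not larger,
`B7Prop1Explicit.norm_inv_sub_one_le`). [cite: Balaban1985RegularSpaces, (1.7) p.77] -/
theorem plaq_pull_of_regPlaqAt {X : Set (Site P 0)} {ε : ℝ} {jl : ℕ} {V : GaugeField P 0 𝔸ˣ} (hV : ∀ b, V b ∈ U1 𝔸)
    (h : RegPlaqAt jl X ε V) (z : LSite P.d) (μ ν : Fin P.d) (hne : μ ≠ ν) (ht : PlaqTouches (pullSet X 0) z μ ν) :
    ‖plaqF (pull V 0) μ ν z - 1‖ < ε * (((P.L : ℝ) ^ jl)⁻¹) ^ 2 := by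
  rw [plaqF_pull]
  rcases lt_or_gt_of_ne hne with hlt | hgt
  · exact h ⟨transl 0 z, μ, ν, hlt⟩ ((plaqTouches_pullSet_iff X z hlt).1 ht)
  · have h' := h ⟨transl 0 z, ν, μ, hgt⟩ ((plaqTouches_pullSet_iff_swap X z hgt).1 ht)
    have hmem : holT V (transl 0 z) (plaqWord ν μ) ∈ U1 𝔸 := by
      rw [← hol_pull_zero]; exact hol_mem_of (V := pull V (transl 0 z)) (fun _ _ => hV _) 0 _
    unfold plaqFT at h' ⊢
    rw [holT_plaqWord_swap]
    exact (B7Prop1Explicit.norm_inv_sub_one_le hmem).trans_lt h'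

omit [NormOneClass 𝔸] [NormedAlgebra ℂ 𝔸] in
/-- **(1.7) FOR THE PULLBACK ⇒ (1.7) ON THE TORUS** (`q.src = 0 + (q.src − 0)`, `transl_rel`). [cite: Balaban1985RegularSpaces, (1.7) p.77] -/
theorem regPlaqAt_of_plaq_pull {X : Set (Site P 0)} {ε : ℝ} {jl : ℕ} {V : GaugeField P 0 𝔸ˣ}
    (h : ∀ (z : LSite P.d) (μ ν : Fin P.d), μ ≠ ν → PlaqTouches (pullSet X 0) z μ ν →
      ‖plaqF (pull V 0) μ ν z - 1‖ < ε * (((P.L : ℝ) ^ jl)⁻¹) ^ 2) :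
    RegPlaqAt jl X ε V := by
  intro q hq
  have hz : transl 0 (rel 0 q.src) = q.src := transl_rel 0 q.src
  have ht : PlaqTouches (pullSet X 0) (rel 0 q.src) q.μ q.ν := by
    rw [plaqTouches_pullSet_iff X _ q.hμν, hz]; exact hq
  have := h (rel 0 q.src) q.μ q.ν (ne_of_lt q.hμν) ht
  rwa [plaqF_pull, hz] at this

omit [NormOneClass 𝔸] in
/-- **(1.9) ON THE TORUS ⟺ (1.9) FOR THE PULLBACK** (`B10Eq68TorusRegularity.covDiv_pull`). [cite: Balaban1985RegularSpaces, (1.9) p.77] -/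
theorem regDivAt_iff_div_pull (X : Set (Site P 0)) (ε η : ℝ) (jl : ℕ) (V : GaugeField P 0 𝔸ˣ) :
    RegDivAt jl X ε η V ↔ ∀ (z : LSite P.d) (μ : Fin P.d), BondTouches (pullSet X 0) z μ →
      ‖covDiv η (pull V 0) μ z‖ < ε * (((P.L : ℝ) ^ jl)⁻¹) ^ 2 * ((P.L : ℝ) ^ jl * η)⁻¹ := by
  constructor
  · intro h z μ hb
    rw [covDiv_pull]
    exact h ⟨transl 0 z, μ⟩ ((bondTouches_pullSet_iff X z μ).1 hb)
  · intro h b hb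
    have hz : transl 0 (rel 0 b.src) = b.src := transl_rel 0 b.src
    have hb' : BondTouches (pullSet X 0) (rel 0 b.src) b.dir := by
      rw [bondTouches_pullSet_iff, hz]; exact hb
    have := h (rel 0 b.src) b.dir hb'
    rwa [covDiv_pull, hz] at this

/-- **[B8] (1.7) + (1.9): `U ∈ 𝔄_k({Ω_j}, α₀)` ON THE TORUS (`B10Eq68TorusRegularity.InSpaceA`, both clauses, every `j ≤ k`) IS THE `ℤᵈ`
LINEAGE'S `B8Ineq132.InAk` OF THE PERIODIC PULLBACK** on the pulled-back domain sequence — for configurations with values in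
`{|u| ≤ 1, |u⁻¹| ≤ 1}` (unitary matrices). [cite: Balaban1985RegularSpaces, (1.7)-(1.9) p.77, (1.33) p.82] -/
theorem inSpaceA_iff_inAk_pull {k : ℕ} {Ω : ℕ → Set (Site P 0)} {ε₀ η : ℝ} {V : GaugeField P 0 𝔸ˣ} (hV : ∀ b, V b ∈ U1 𝔸) :
    InSpaceA k Ω ε₀ η V ↔ InAk P.L k η ε₀ (pullDom Ω) (pull V 0) := by
  constructor
  · intro h jl hjl
    refine ⟨fun z μ ν hne ht => plaq_pull_of_regPlaqAt hV (h jl hjl).1 z μ ν hne ht, ?_⟩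
    exact (regDivAt_iff_div_pull (Ω jl) ε₀ η jl V).1 (h jl hjl).2
  · intro h jl hjl
    exact ⟨regPlaqAt_of_plaq_pull (h jl hjl).1, (regDivAt_iff_div_pull (Ω jl) ε₀ η jl V).2 (h jl hjl).2⟩

end RegularityClass

section UnitaryGroup

open scoped Matrix.Norms.L2Operator

variable {N : ℕ} [NeZero N]

/-- **FOR THE CELL'S `U(N)`**: `U ∈ 𝔄_k({Ω_j}, α₀)` on the torus (`B10Eq68TorusRegularity.InSpace`, the class of [7] (2) = [B8] (1.7)+(1.9) in
which `T3PrintedRegularMinimiser.RegPr` ∕ the T⁴ END read their configurations) IFF the `ℤᵈ` pullback of `U` (read in the units of `M_N(ℂ)`,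
`unitsField`) lies in `B8Ineq132.InAk` — the hypothesis letter (1.33)₁ ∕ (1.34)₁ of `B8Thm4TorusAt.Thm4TorusAt` and `B8Thm2TorusAt.Thm2TorusAt`.
[cite: Balaban1985RegularSpaces, (1.7)-(1.9) p.77, (1.33)-(1.34) p.82] -/
theorem inSpace_iff_inAk_pull (k : ℕ) (Ω : ℕ → Set (Site P 0)) (ε₀ η : ℝ) (U : GaugeField P 0 (Matrix.unitaryGroup (Fin N) ℂ)) :
    InSpace k Ω ε₀ η U ↔ InAk P.L k η ε₀ (pullDom Ω) (pull (unitsField U) 0) := by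
  letI : CStarAlgebra (Matrix (Fin N) (Fin N) ℂ) := B10Eq29TubeLine.cstarAlgebraMatrix N
  exact inSpaceA_iff_inAk_pull fun b => unitaryUnits_le_U1 (unitsField_mem_unitaryUnits U b)

/-- The all-torus case: `U ∈ 𝔄_k({T_η}, α₀)` iff `InAk L k η α₀ (fun _ ↦ univ) (U♯)`. [cite: Balaban1985RegularSpaces, (1.33) p.82, p.77 («Ω_j = T_η»)] -/
theorem inSpace_univ_iff_inAk_pull (k : ℕ) (ε₀ η : ℝ) (U : GaugeField P 0 (Matrix.unitaryGroup (Fin N) ℂ)) :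
    InSpace k (fun _ => (Set.univ : Set (Site P 0))) ε₀ η U ↔
      InAk P.L k η ε₀ (fun _ => (Set.univ : Set (LSite P.d))) (pull (unitsField U) 0) := by
  rw [inSpace_iff_inAk_pull, pullDom_univ]

end UnitaryGroup

/-! ## §3 Descent of periodic `ℤᵈ` configurations; the letters of Theorem 2 AT THE SETUP-TORUS OBJECTS (`U(N)`, one `Params`, `k` levels) -/

section Descent

variable {G : Type*}

/-- **DESCENT of a `ℤᵈ` configuration (bond field, any values) to the torus, based at `y`**: `(W♭_y)(⟨x, μ⟩) := W(x − y, μ)`; for an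
`n`-PERIODIC `W` this inverts `pull` (`pull_descendCfg`). [cite: Balaban1985RegularSpaces, (1.3) p.77] -/
def descendCfg (W : LSite P.d → Fin P.d → G) (y : Site P j) : GaugeField P j G := fun b => W (rel y b.src) b.dir

/-- Unfolding `descendCfg`. [cite: Balaban1985RegularSpaces, (1.3) p.77] -/
theorem descendCfg_apply (W : LSite P.d → Fin P.d → G) (y : Site P j) (b : PBond P j) : descendCfg W y b = W (rel y b.src) b.dir := rfl

/-- Descending the pullback gives back the torus configuration. [cite: Balaban1985RegularSpaces, (1.3) p.77] -/
theorem descendCfg_pull (V : GaugeField P j G) (y : Site P j) : descendCfg (pull V y) y = V := by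
  funext b
  rw [descendCfg_apply, pull_apply, transl_rel]

/-- **An `n`-periodic `ℤᵈ` configuration IS the pullback of its descent** (`n = sitesPerDir j`). [cite: Balaban1985RegularSpaces, (1.3) p.77] -/
theorem pull_descendCfg {W : LSite P.d → Fin P.d → G} (y : Site P j)
    (hW : ∀ i : Fin P.d, shiftCfg (((P.sitesPerDir j : ℕ) : ℤ) • e i) W = W) : pull (descendCfg W y) y = W := by
  funext z μ
  have hWμ : ∀ (x : LSite P.d) (i : Fin P.d), (fun x' => W x' μ) (x + ((P.sitesPerDir j : ℕ) : ℤ) • e i) = (fun x' => W x' μ) x := by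
    intro x i
    have := congrFun (congrFun (hW i) x) μ
    simpa [B12Ineq417Flat.shiftCfg_apply] using this
  have key := congrFun (pullGauge_descendGauge (G := G) (u := fun x' => W x' μ) y hWμ) z
  rw [pullGauge_apply, descendGauge_apply] at key
  rw [pull_apply, descendCfg_apply]
  exact key

end Descent

section SetupLetters

open scoped Matrix.Norms.L2Operator

variable (P) {N : ℕ}

/-- **THE `ℤᵈ` READING OF A `U(N)` TORUS CONFIGURATION** used by the N05 ∕ N16 interfaces: the periodic pullback from the origin, read in the
units of `M_N(ℂ)` — `U♯ := (unitsField U)♯_0`. [cite: Balaban1985RegularSpaces, (1.3) p.77; Balaban1985Averaging, (19) p.21] -/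
def cfgPull (U : GaugeField P 0 (Matrix.unitaryGroup (Fin N) ℂ)) : LSite P.d → Fin P.d → (Matrix (Fin N) (Fin N) ℂ)ˣ :=
  pull (unitsField U) 0

/-- **THE `ℤᵈ` READING OF A `U(N)` TORUS GAUGE TRANSFORMATION**: `u♯ := (toUnits ∘ u)♯_0`. [cite: Balaban1985Averaging, (8) p.19, (19) p.21] -/
def gaugePull (u : GaugeTransf P 0 (Matrix.unitaryGroup (Fin N) ℂ)) : LSite P.d → (Matrix (Fin N) (Fin N) ℂ)ˣ :=
  pullGauge (fun x => Unitary.toUnits (u x)) 0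

variable {P}

/-- Unfolding `cfgPull`. [cite: Balaban1985RegularSpaces, (1.3) p.77] -/
theorem cfgPull_apply (U : GaugeField P 0 (Matrix.unitaryGroup (Fin N) ℂ)) (z : LSite P.d) (μ : Fin P.d) :
    cfgPull P U z μ = unitsField U ⟨transl 0 z, μ⟩ := rfl

/-- Unfolding `gaugePull`. [cite: Balaban1985Averaging, (8) p.19] -/
theorem gaugePull_apply (u : GaugeTransf P 0 (Matrix.unitaryGroup (Fin N) ℂ)) (z : LSite P.d) :
    gaugePull P u z = Unitary.toUnits (u (transl 0 z)) := rfl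

/-- `U♯` is unitary-valued. [cite: Balaban1985Averaging, (19) p.21] -/
theorem cfgPull_mem (U : GaugeField P 0 (Matrix.unitaryGroup (Fin N) ℂ)) (z : LSite P.d) (μ : Fin P.d) :
    cfgPull P U z μ ∈ unitaryUnits (Matrix (Fin N) (Fin N) ℂ) :=
  unitsField_mem_unitaryUnits U _

/-- `u♯` is unitary-valued. [cite: Balaban1985Averaging, (19) p.21] -/
theorem gaugePull_mem (u : GaugeTransf P 0 (Matrix.unitaryGroup (Fin N) ℂ)) (z : LSite P.d) :
    gaugePull P u z ∈ unitaryUnits (Matrix (Fin N) (Fin N) ℂ) := by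
  rw [mem_unitaryUnits, gaugePull_apply, Unitary.val_toUnits_apply]
  exact (u (transl 0 z)).2

/-- `U♯` is `sitesPerDir 0`-periodic. [cite: Balaban1985RegularSpaces, (1.3) p.77] -/
theorem cfgPull_periodic (U : GaugeField P 0 (Matrix.unitaryGroup (Fin N) ℂ)) (i : Fin P.d) :
    shiftCfg (((P.sitesPerDir 0 : ℕ) : ℤ) • e i) (cfgPull P U) = cfgPull P U :=
  pull_periodic _ 0 i

/-- `u♯` is `sitesPerDir 0`-periodic. [cite: Balaban1985RegularSpaces, (1.3) p.77] -/
theorem gaugePull_periodic (u : GaugeTransf P 0 (Matrix.unitaryGroup (Fin N) ℂ)) (z : LSite P.d) (i : Fin P.d) :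
    gaugePull P u (z + ((P.sitesPerDir 0 : ℕ) : ℤ) • e i) = gaugePull P u z :=
  pullGauge_periodic _ 0 z i

/-- The pullback of a bondwise product is the product of the pullbacks (`U′U₀` of (1.16) read on `ℤᵈ`). [cite: Balaban1985RegularSpaces, (1.16) p.78] -/
theorem cfgPull_mul (U' U₀ : GaugeField P 0 (Matrix.unitaryGroup (Fin N) ℂ)) :
    cfgPull P (fun b => U' b * U₀ b) = cfgPull P U' * cfgPull P U₀ := by
  funext z μ
  simp only [cfgPull_apply, Pi.mul_apply]
  apply Units.ext
  rw [val_unitsField, Units.val_mul, val_unitsField, val_unitsField]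
  rfl

/-- `gaugePull` is injective (a torus gauge transformation is recovered from its pullback by descent). [cite: Balaban1985Averaging, (8) p.19] -/
theorem gaugePull_injective : Function.Injective (gaugePull P (N := N)) := by
  intro u u' h
  have h' : descendGauge (gaugePull P u) (0 : Site P 0) = descendGauge (gaugePull P u') 0 := by rw [h]
  unfold gaugePull at h'
  rw [descendGauge_pullGauge, descendGauge_pullGauge] at h'
  funext x
  exact Unitary.toUnits_injective (congrFun h' x)

/-- **DESCENT OF A PERIODIC UNITARY-VALUED `ℤᵈ` GAUGE TRANSFORMATION TO A `U(N)` TORUS GAUGE TRANSFORMATION** whose pullback it is.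
[cite: Balaban1985RegularSpaces, (1.3) p.77; Balaban1985Averaging, (8) p.19] -/
theorem exists_gaugePull_eq {v : LSite P.d → (Matrix (Fin N) (Fin N) ℂ)ˣ} (hv : ∀ z, v z ∈ unitaryUnits (Matrix (Fin N) (Fin N) ℂ))
    (hper : ∀ (z : LSite P.d) (i : Fin P.d), v (z + ((P.sitesPerDir 0 : ℕ) : ℤ) • e i) = v z) :
    ∃ u : GaugeTransf P 0 (Matrix.unitaryGroup (Fin N) ℂ), gaugePull P u = v := by
  refine ⟨fun x => ⟨((v (rel 0 x) : (Matrix (Fin N) (Fin N) ℂ)ˣ) : Matrix (Fin N) (Fin N) ℂ), (mem_unitaryUnits).1 (hv _)⟩, ?_⟩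
  have key := pullGauge_descendGauge (G := (Matrix (Fin N) (Fin N) ℂ)ˣ) (u := v) (0 : Site P 0) hper
  funext z
  have kz := congrFun key z
  rw [pullGauge_apply, descendGauge_apply] at kz
  rw [gaugePull_apply, ← kz]
  exact Units.ext rfl

/-- **DESCENT OF A PERIODIC `ℤᵈ` ONE-FORM** (`A` of (1.36)) to a torus one-form whose pullback it is. [cite: Balaban1985RegularSpaces, (1.36) p.82] -/
theorem exists_pull_eq_form {A : LSite P.d → Fin P.d → Matrix (Fin N) (Fin N) ℂ}
    (hA : ∀ (x : LSite P.d) (i : Fin P.d) (μ : Fin P.d), A (x + ((P.sitesPerDir 0 : ℕ) : ℤ) • e i) μ = A x μ) :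
    ∃ X : GaugeField P 0 (Matrix (Fin N) (Fin N) ℂ), pull X 0 = A :=
  ⟨descendCfg A 0, pull_descendCfg 0 fun i => by funext x μ; simpa [B12Ineq417Flat.shiftCfg_apply] using hA x i μ⟩

variable (P)

/-- **(1.34)₂ «U′U₀ ∈ Ax_k(𝔅_k, U₀)» AT THE SETUP-TORUS OBJECTS, `Ω_j = T_η`** (`𝔅_k = T^{(k)}`): the axial gauge (1.19) relative to `U₀` of the
full field `U`, read as `B8Eq119TwistedAxial.InAx L k (torusLam k)` on the pullbacks. [cite: Balaban1985RegularSpaces, (1.19)–(1.20) p.79, (1.34) p.82] -/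
def InAxT (k : ℕ) (U₀ U : GaugeField P 0 (Matrix.unitaryGroup (Fin N) ℂ)) : Prop :=
  InAx P.L k (torusLam k) (cfgPull P U₀) (cfgPull P U)

/-- **(1.29) «(R̄₀uʲ)(y) = 1 for y ∈ Λ_j, j = 0, …, k» AT THE SETUP-TORUS OBJECTS, `Ω_j = T_η`**: the averaging (78)–(80) of [3] of the gauge
transformation relative to `U₀` is trivial on `Λ_k = T^{(k)}`, read as `B8Eq119TwistedAxial.Restr129 L k (torusLam k)` on the pullbacks.
[cite: Balaban1985RegularSpaces, (1.29) p.81; Balaban1985Averaging, (78)–(80) p.30] -/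
def Restr129T (k : ℕ) (U₀ : GaugeField P 0 (Matrix.unitaryGroup (Fin N) ℂ)) (u : GaugeTransf P 0 (Matrix.unitaryGroup (Fin N) ℂ)) : Prop :=
  Restr129 P.L k (torusLam k) (cfgPull P U₀) (gaugePull P u)

/-- **(1.35) AT THE SETUP-TORUS OBJECTS, `Ω_j = T_η`**: the (1.35) of record `B8Eq133Hypotheses.Hyp135 L k (torusLam k)` on the pullbacks
(print's averaging (43) of [3], `B7Prop2Explicit.avgIter`; on the torus this is `B10Eq69TorusPullback.avgT` by its definition).
[cite: Balaban1985RegularSpaces, (1.35) p.82; Balaban1985Averaging, (43) p.24] -/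
def Hyp135T (k : ℕ) (α₁ : ℝ) (U₀ U' : GaugeField P 0 (Matrix.unitaryGroup (Fin N) ℂ)) : Prop :=
  Hyp135 P.L k (torusLam k) α₁ (cfgPull P U₀) (cfgPull P U')

/-- **THE CONCLUSION (1.36)–(1.39) OF THEOREM 2 AT THE SETUP-TORUS OBJECTS** for `U₁ = U′^{u⁻¹}`, `Ω_j = T_η`: there is a bondwise self-adjoint
torus one-form `A : bonds of T_η → M_N(ℂ)` with «U₁ = e^{iηA}» — `mgauge U₀♯ (u♯)⁻¹ U′♯ = cfgExp η A♯` on the pullbacks — and (1.36) `C136T`,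
(1.37) `C137T`, (1.38) `IsLandau138 … univ (torusLam k)`, (1.39) `C139T` of `B8Thm2TorusAt` for `A♯`, `U₀♯` (same readings of record).
[cite: Balaban1985RegularSpaces, Thm 2 p.83, (1.36)–(1.38) p.82, (1.39) p.83] -/
def Concl2Setup (k : ℕ) (η β₀ B₁ B₂ : ℝ) (len : LSite P.d → ℝ) (α₀ α₁ : ℝ) (U₀ U' : GaugeField P 0 (Matrix.unitaryGroup (Fin N) ℂ))
    (u : GaugeTransf P 0 (Matrix.unitaryGroup (Fin N) ℂ)) : Prop :=
  ∃ A : GaugeField P 0 (Matrix (Fin N) (Fin N) ℂ),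
    (∀ b : PBond P 0, IsSelfAdjoint (A b)) ∧
    B7Eq92Concrete.mgauge (cfgPull P U₀) (gaugePull P u)⁻¹ (cfgPull P U') = B8Eq184Proof.cfgExp η (pull A 0) ∧
    B8Thm2TorusAt.C136T P.L k η β₀ B₁ B₂ len (α₀ + α₁) (cfgPull P U₀) (pull A 0) ∧
    B8Thm2TorusAt.C137T P.L k η α₁ (cfgPull P U₀) (pull A 0) ∧
    B8Eq138LandauZd.IsLandau138 P.L k η (Set.univ : Set (LSite P.d)) (torusLam k) (cfgPull P U₀) (pull A 0) ∧
    B8Thm2TorusAt.C139T P.L k η B₁ (α₀ + α₁) (cfgPull P U₀) (pull A 0)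

variable {P}

/-- **`Concl2Setup` IS `B8Thm2TorusAt.Concl2T` READ ON THE PULLBACKS** (period `sitesPerDir 0`): a torus one-form pulls back to a periodic one,
a periodic `ℤᵈ` one-form descends (`exists_pull_eq_form`). [cite: Balaban1985RegularSpaces, Thm 2 p.83, (1.36) p.82] -/
theorem concl2Setup_iff (k : ℕ) (η β₀ B₁ B₂ : ℝ) (len : LSite P.d → ℝ) (α₀ α₁ : ℝ)
    (U₀ U' : GaugeField P 0 (Matrix.unitaryGroup (Fin N) ℂ)) (u : GaugeTransf P 0 (Matrix.unitaryGroup (Fin N) ℂ)) :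
    Concl2Setup P k η β₀ B₁ B₂ len α₀ α₁ U₀ U' u ↔
      Concl2T P.L k (((P.sitesPerDir 0 : ℕ) : ℤ)) η β₀ B₁ B₂ len α₀ α₁ (cfgPull P U₀) (cfgPull P U') (gaugePull P u) := by
  constructor
  · rintro ⟨A, hsa, hexp, h36, h37, h38, h39⟩
    refine ⟨pull A 0, fun z μ => hsa _, fun x i μ => ?_, hexp, h36, h37, h38, h39⟩
    have := congrFun (congrFun (pull_periodic A (0 : Site P 0) i) x) μ
    simpa [B12Ineq417Flat.shiftCfg_apply] using this
  · rintro ⟨A, hsa, hper, hexp, h36, h37, h38, h39⟩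
    obtain ⟨X, hX⟩ := exists_pull_eq_form (P := P) hper
    subst hX
    exact ⟨X, fun b => by simpa [pull_apply, transl_rel] using hsa (rel 0 b.src) b.dir, hexp, h36, h37, h38, h39⟩

end SetupLetters

/-! ## §4 THEOREM 2 AT THE SETUP-TORUS OBJECTS (`Ω_j = T_η`; gauge group `G ≤ U(N)`; one `Params`), and its derivation from `B8Thm2TorusAt.Thm2TorusAt` -/

section SetupInterface

open scoped Matrix.Norms.L2Operator

variable (P) (N : ℕ)

/-- **INTERFACE (HYPOTHESIS SHAPE) — [B8] THEOREM 2 (p. 83) FOR `Ω_j = T_η` AT THE SETUP-TORUS OBJECTS**: backgrounds `U₀` and perturbations `U′`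
are configurations of the finest lattice `Site P 0` of the `Setup` torus with values in a gauge group `G ≤ U(N)` (carried as `U(N)` configurations
`GaugeField P 0 (Matrix.unitaryGroup (Fin N) ℂ)` with `G`-valued bond variables, `G : Subgroup (M_N(ℂ))ˣ`; `SU(N)` = `B7Prop2SpecialUnitary.specialUnitaryUnits`
through `B10Eq27TorusAxialLog.toUField`), the gauge transformation `u` ranges over the `G`-valued `GaugeTransf P 0 (Matrix.unitaryGroup (Fin N) ℂ)`
and is UNIQUE THERE; (1.33) = the LQB lane's two-clause class `B10Eq68TorusRegularity.InSpace k {T_η} α₀ η U₀` ∧ «(3.35) of [4]» (`Reg U₀♯`,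
abstract as in `Thm2TorusAt`); (1.34) = `InSpace … (U′U₀)` ∧ `InAxT`; (1.35) = `Hyp135T`; CONCLUSION: exactly one `G`-valued `u` with (1.29)
`Restr129T` and (1.36)–(1.39) `Concl2Setup`.  The Setup-object companion of `B8Thm2TorusAt.Thm2TorusAt`, from which it FOLLOWS
(`thm2SetupAt_of_thm2TorusAt`); asserted for nothing. [cite: Balaban1985RegularSpaces, Thm 2 p.83, (1.33)–(1.38) p.82, (1.39) p.83, (1.29) p.81, p.77 («Ω_j = T_η for j = 0,1,…,l, l ≤ k»)] -/
def Thm2SetupAt (k : ℕ) (η β₀ B₁ B₂ c₁ : ℝ) (len : LSite P.d → ℝ) (G : Subgroup (Matrix (Fin N) (Fin N) ℂ)ˣ)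
    (Reg : (LSite P.d → Fin P.d → (Matrix (Fin N) (Fin N) ℂ)ˣ) → Prop) : Prop :=
  ∀ ⦃α₀ α₁ : ℝ⦄, 0 < α₀ → 0 < α₁ → α₀ + α₁ ≤ c₁ →
    ∀ U₀ U' : GaugeField P 0 (Matrix.unitaryGroup (Fin N) ℂ), (∀ b, unitsField U₀ b ∈ G) → (∀ b, unitsField U' b ∈ G) →
      InSpace k (fun _ => (Set.univ : Set (Site P 0))) α₀ η U₀ → Reg (cfgPull P U₀) →
      InSpace k (fun _ => (Set.univ : Set (Site P 0))) α₀ η (fun b => U' b * U₀ b) → InAxT P k U₀ (fun b => U' b * U₀ b) →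
      Hyp135T P k α₁ U₀ U' →
      ∃ u : GaugeTransf P 0 (Matrix.unitaryGroup (Fin N) ℂ),
        ((∀ x, Unitary.toUnits (u x) ∈ G) ∧ Restr129T P k U₀ u ∧ Concl2Setup P k η β₀ B₁ B₂ len α₀ α₁ U₀ U' u) ∧
        ∀ u' : GaugeTransf P 0 (Matrix.unitaryGroup (Fin N) ℂ), (∀ x, Unitary.toUnits (u' x) ∈ G) →
          Restr129T P k U₀ u' → Concl2Setup P k η β₀ B₁ B₂ len α₀ α₁ U₀ U' u' → u' = u

variable {P N}
variable [NeZero N]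

/-- **THE JUNCTION: `Thm2TorusAt` (periodic-`ℤᵈ` reading, period `sitesPerDir 0`, gauge group `G ≤ unitaryUnits M_N(ℂ)`) ⟹ `Thm2SetupAt`
(Setup-torus objects).**  The torus data pull back to periodic `G`-valued `ℤᵈ` data in `𝔄_k` (`inSpace_univ_iff_inAk_pull`, `cfgPull_periodic`,
`cfgPull_mul`); the periodic `ℤᵈ` gauge transformation DESCENDS to the torus (`exists_gaugePull_eq`), its exponent field descends
(`concl2Setup_iff`); uniqueness on the torus follows from uniqueness among periodic `ℤᵈ` gauges (`gaugePull_injective`).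
[cite: Balaban1985RegularSpaces, Thm 2 p.83, p.77 («Ω_j = T_η»)] -/
theorem thm2SetupAt_of_thm2TorusAt {k : ℕ} {η β₀ B₁ B₂ c₁ : ℝ} {len : LSite P.d → ℝ} {G : Subgroup (Matrix (Fin N) (Fin N) ℂ)ˣ}
    (hG : G ≤ unitaryUnits (Matrix (Fin N) (Fin N) ℂ)) {Reg : (LSite P.d → Fin P.d → (Matrix (Fin N) (Fin N) ℂ)ˣ) → Prop}
    (h : Thm2TorusAt P.L k (((P.sitesPerDir 0 : ℕ) : ℤ)) η β₀ B₁ B₂ c₁ len G Reg) :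
    Thm2SetupAt P N k η β₀ B₁ B₂ c₁ len G Reg := by
  intro α₀ α₁ hα₀ hα₁ hc U₀ U' hU₀G hU'G h33 hReg h34 h34' h35
  have h33' := (inSpace_univ_iff_inAk_pull k α₀ η U₀).1 h33
  have h34'' : InAk P.L k η α₀ (fun _ => (Set.univ : Set (LSite P.d))) (cfgPull P U' * cfgPull P U₀) := by
    rw [← cfgPull_mul]; exact (inSpace_univ_iff_inAk_pull k α₀ η _).1 h34
  have hax : InAx P.L k (torusLam k) (cfgPull P U₀) (cfgPull P U' * cfgPull P U₀) := by
    have := h34'; unfold InAxT at this; rwa [cfgPull_mul] at this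
  obtain ⟨v, ⟨hvG, hvP, h129, hC⟩, huniq⟩ := h hα₀ hα₁ hc (cfgPull P U₀) (cfgPull P U') (fun z μ => hU₀G _) (fun z μ => hU'G _)
    (cfgPull_periodic U₀) (cfgPull_periodic U') h33' hReg h34'' hax h35
  obtain ⟨u, hu⟩ := exists_gaugePull_eq (P := P) (fun z => hG (hvG z)) hvP
  subst hu
  refine ⟨u, ⟨fun x => ?_, h129, (concl2Setup_iff k η β₀ B₁ B₂ len α₀ α₁ U₀ U' u).2 hC⟩, fun u' hu'G h129' hC' => ?_⟩
  · have := hvG (rel 0 x)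
    rwa [gaugePull_apply, transl_rel] at this
  · exact gaugePull_injective (huniq (gaugePull P u') (fun z => hu'G _) (gaugePull_periodic u') h129'
      ((concl2Setup_iff k η β₀ B₁ B₂ len α₀ α₁ U₀ U' u').1 hC'))

/-- **… and from print's quantifier order** (`B8Thm2TorusAt.Thm2TorusUniform`): ONE triple `(B₁, B₂, c₁)` serves every `k ≥ 1` and every `η > 0`
at the Setup-torus objects of `P`. [cite: Balaban1985RegularSpaces, Thm 2 p.83, p.83 (sentence after (1.39))] -/
theorem thm2SetupAt_of_uniform {β₀ : ℝ} {len : LSite P.d → ℝ} {G : Subgroup (Matrix (Fin N) (Fin N) ℂ)ˣ}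
    (hG : G ≤ unitaryUnits (Matrix (Fin N) (Fin N) ℂ)) {Reg : ℕ → ℤ → ℝ → (LSite P.d → Fin P.d → (Matrix (Fin N) (Fin N) ℂ)ˣ) → Prop}
    (h : B8Thm2TorusAt.Thm2TorusUniform P.L β₀ len G Reg) :
    ∃ B₁ B₂ c₁ : ℝ, 0 < B₁ ∧ 0 < B₂ ∧ 0 < c₁ ∧ ∀ (k : ℕ) (η : ℝ), 1 ≤ k → 0 < η →
      Thm2SetupAt P N k η β₀ B₁ B₂ c₁ len G (Reg k (((P.sitesPerDir 0 : ℕ) : ℤ)) η) := by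
  obtain ⟨B₁, B₂, c₁, hB₁, hB₂, hc₁, H⟩ := h
  exact ⟨B₁, B₂, c₁, hB₁, hB₂, hc₁, fun k η hk hη => thm2SetupAt_of_thm2TorusAt hG (H k _ η hk hη)⟩

/-- The `U(N)` instance: for `G = unitaryUnits M_N(ℂ)` the value clauses hold for every `U(N)` configuration ∕ gauge transformation
(`unitsField_mem_unitaryUnits`, `gaugePull_mem`). [cite: Balaban1985RegularSpaces, Thm 2 p.83] -/
theorem thm2SetupAt_unitary_apply {k : ℕ} {η β₀ B₁ B₂ c₁ : ℝ} {len : LSite P.d → ℝ}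
    {Reg : (LSite P.d → Fin P.d → (Matrix (Fin N) (Fin N) ℂ)ˣ) → Prop}
    (h : Thm2TorusAt P.L k (((P.sitesPerDir 0 : ℕ) : ℤ)) η β₀ B₁ B₂ c₁ len (unitaryUnits (Matrix (Fin N) (Fin N) ℂ)) Reg)
    {α₀ α₁ : ℝ} (hα₀ : 0 < α₀) (hα₁ : 0 < α₁) (hc : α₀ + α₁ ≤ c₁) (U₀ U' : GaugeField P 0 (Matrix.unitaryGroup (Fin N) ℂ))
    (h33 : InSpace k (fun _ => (Set.univ : Set (Site P 0))) α₀ η U₀) (hReg : Reg (cfgPull P U₀))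
    (h34 : InSpace k (fun _ => (Set.univ : Set (Site P 0))) α₀ η (fun b => U' b * U₀ b)) (h34' : InAxT P k U₀ (fun b => U' b * U₀ b))
    (h35 : Hyp135T P k α₁ U₀ U') :
    ∃ u : GaugeTransf P 0 (Matrix.unitaryGroup (Fin N) ℂ),
      (Restr129T P k U₀ u ∧ Concl2Setup P k η β₀ B₁ B₂ len α₀ α₁ U₀ U' u) ∧
      ∀ u' : GaugeTransf P 0 (Matrix.unitaryGroup (Fin N) ℂ),
        Restr129T P k U₀ u' → Concl2Setup P k η β₀ B₁ B₂ len α₀ α₁ U₀ U' u' → u' = u := by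
  obtain ⟨u, ⟨-, h129, hC⟩, huniq⟩ := thm2SetupAt_of_thm2TorusAt le_rfl h hα₀ hα₁ hc U₀ U'
    (fun b => unitsField_mem_unitaryUnits U₀ b) (fun b => unitsField_mem_unitaryUnits U' b) h33 hReg h34 h34' h35
  refine ⟨u, ⟨h129, hC⟩, fun u' h129' hC' => huniq u' (fun x => ?_) h129' hC'⟩
  have := gaugePull_mem (P := P) u' (rel 0 x)
  rwa [gaugePull_apply, transl_rel] at this

/-- The `SU(N)` instance: `G = B7Prop2SpecialUnitary.specialUnitaryUnits (Fin N)` is a subgroup of `unitaryUnits M_N(ℂ)`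
(`specialUnitaryUnits_le_unitaryUnits`), so the junction applies verbatim; backgrounds, perturbations and the gauge transformation are then
`SU(N)`-valued and uniqueness is among `SU(N)`-valued gauge transformations of the Setup torus. [cite: Balaban1985RegularSpaces, Thm 2 p.83] -/
theorem thm2SetupAt_specialUnitary_of_thm2TorusAt {k : ℕ} {η β₀ B₁ B₂ c₁ : ℝ} {len : LSite P.d → ℝ}
    {Reg : (LSite P.d → Fin P.d → (Matrix (Fin N) (Fin N) ℂ)ˣ) → Prop}
    (h : Thm2TorusAt P.L k (((P.sitesPerDir 0 : ℕ) : ℤ)) η β₀ B₁ B₂ c₁ len (B7Prop2SpecialUnitary.specialUnitaryUnits (Fin N)) Reg) :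
    Thm2SetupAt P N k η β₀ B₁ B₂ c₁ len (B7Prop2SpecialUnitary.specialUnitaryUnits (Fin N)) Reg :=
  thm2SetupAt_of_thm2TorusAt B7Prop2SpecialUnitary.specialUnitaryUnits_le_unitaryUnits h

end SetupInterface

/-! ## §5 The `SU(N)`-NATIVE form: fields and gauge transformations valued in `Matrix.specialUnitaryGroup (Fin N) ℂ`, read in `U(N)` through
`B10Eq27TorusAxialLog.toUField` ∕ `suIncl` — the shape of the T³ lane's carriers (`T3SectALandauChart.Resid`, `SU(2)`) -/

section SpecialUnitary

open scoped Matrix.Norms.L2Operator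
open B10Eq27TorusAxialLog (suIncl val_suIncl)
open B7Prop2SpecialUnitary (specialUnitaryUnits mem_specialUnitaryUnits)

variable (P) (N : ℕ)

/-- An `SU(N)`-valued torus gauge transformation read as a `U(N)`-valued one (pointwise `suIncl`, as `toUField` does for configurations;
the reading of `T3PrintedRegularOrbits`). (bookkeeping of the `U(N)` model of [Balaban1985Averaging] (19), no content of the series)
[cite: Balaban1985Averaging, (19) p.21] -/
def toUGauge (u : GaugeTransf P 0 (Matrix.specialUnitaryGroup (Fin N) ℂ)) : GaugeTransf P 0 (Matrix.unitaryGroup (Fin N) ℂ) :=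
  fun x => suIncl (u x)

variable {P N}

/-- Unfolding `toUGauge`. [cite: Balaban1985Averaging, (19) p.21] -/
@[simp] theorem toUGauge_apply (u : GaugeTransf P 0 (Matrix.specialUnitaryGroup (Fin N) ℂ)) (x : Site P 0) :
    toUGauge P N u x = suIncl (u x) := rfl

/-- `toUGauge` is injective (same matrices). [cite: Balaban1985Averaging, (19) p.21] -/
theorem toUGauge_injective : Function.Injective (toUGauge P N) := by
  intro u u' h
  funext x
  have hx := congrArg (fun g : Matrix.unitaryGroup (Fin N) ℂ => (g : Matrix (Fin N) (Fin N) ℂ)) (congrFun h x)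
  simp only [toUGauge_apply, val_suIncl] at hx
  exact Subtype.ext hx

/-- The values of `toUGauge u`, read in the units of `M_N(ℂ)`, lie in `SU(N)` = `B7Prop2SpecialUnitary.specialUnitaryUnits`.
[cite: Balaban1985Averaging, (19) p.21, p.20] -/
theorem toUnits_toUGauge_mem (u : GaugeTransf P 0 (Matrix.specialUnitaryGroup (Fin N) ℂ)) (x : Site P 0) :
    Unitary.toUnits (toUGauge P N u x) ∈ specialUnitaryUnits (Fin N) := by
  rw [mem_specialUnitaryUnits]
  exact (u x).2

/-- The bond variables of `toUField U`, read in the units of `M_N(ℂ)` (`unitsField`), lie in `SU(N)`. [cite: Balaban1985Averaging, (19) p.21, p.20] -/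
theorem unitsField_toUField_mem (U : GaugeField P 0 (Matrix.specialUnitaryGroup (Fin N) ℂ)) (b : PBond P 0) :
    unitsField (toUField U) b ∈ specialUnitaryUnits (Fin N) := by
  rw [mem_specialUnitaryUnits]
  exact (U b).2

/-- A `U(N)`-valued torus gauge transformation with values in `SU(N)` IS `toUGauge` of an `SU(N)`-valued one. [cite: Balaban1985Averaging, (19) p.21] -/
theorem exists_toUGauge_eq {v : GaugeTransf P 0 (Matrix.unitaryGroup (Fin N) ℂ)} (hv : ∀ x, Unitary.toUnits (v x) ∈ specialUnitaryUnits (Fin N)) :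
    ∃ u : GaugeTransf P 0 (Matrix.specialUnitaryGroup (Fin N) ℂ), toUGauge P N u = v :=
  ⟨fun x => ⟨((v x : Matrix.unitaryGroup (Fin N) ℂ) : Matrix (Fin N) (Fin N) ℂ), (mem_specialUnitaryUnits).1 (hv x)⟩,
    funext fun _ => Subtype.ext rfl⟩

/-- `toUField` is multiplicative bondwise (`suIncl` is a homomorphism): `(U′U₀)^U = U′^U U₀^U`. [cite: Balaban1985Averaging, (19) p.21] -/
theorem toUField_mul (U' U₀ : GaugeField P 0 (Matrix.specialUnitaryGroup (Fin N) ℂ)) :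
    toUField (fun b => U' b * U₀ b) = fun b => toUField U' b * toUField U₀ b := by
  funext b
  exact Subtype.ext rfl

variable (P N)

/-- **INTERFACE (HYPOTHESIS SHAPE) — [B8] THEOREM 2 (p. 83) FOR `Ω_j = T_η` AT `SU(N)`-VALUED SETUP-TORUS OBJECTS**: the same sentence as
`Thm2SetupAt` with backgrounds `U₀`, perturbations `U′` in `GaugeField P 0 (Matrix.specialUnitaryGroup (Fin N) ℂ)` and the gauge
transformation ranging over `GaugeTransf P 0 (Matrix.specialUnitaryGroup (Fin N) ℂ)`, UNIQUE THERE; every letter is read in `U(N)` through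
`toUField` ∕ `toUGauge` (the T³ lane's reading: `T3PrintedRegularMinimiser`, `T3SectALandauChart.bgUnits = unitsField ∘ toUField`).  FOLLOWS from
`Thm2SetupAt … (specialUnitaryUnits (Fin N))` (`thm2SetupSUAt_of_thm2SetupAt`), hence from `B8Thm2TorusAt.Thm2TorusAt` at the gauge group
`specialUnitaryUnits (Fin N)` (`thm2SetupSUAt_of_thm2TorusAt`); asserted for nothing.
[cite: Balaban1985RegularSpaces, Thm 2 p.83, (1.33)–(1.38) p.82, (1.39) p.83, (1.29) p.81, p.77 («Ω_j = T_η for j = 0,1,…,l, l ≤ k»)] -/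
def Thm2SetupSUAt (k : ℕ) (η β₀ B₁ B₂ c₁ : ℝ) (len : LSite P.d → ℝ)
    (Reg : (LSite P.d → Fin P.d → (Matrix (Fin N) (Fin N) ℂ)ˣ) → Prop) : Prop :=
  ∀ ⦃α₀ α₁ : ℝ⦄, 0 < α₀ → 0 < α₁ → α₀ + α₁ ≤ c₁ →
    ∀ U₀ U' : GaugeField P 0 (Matrix.specialUnitaryGroup (Fin N) ℂ),
      InSpace k (fun _ => (Set.univ : Set (Site P 0))) α₀ η (toUField U₀) → Reg (cfgPull P (toUField U₀)) →
      InSpace k (fun _ => (Set.univ : Set (Site P 0))) α₀ η (toUField (fun b => U' b * U₀ b)) →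
      InAxT P k (toUField U₀) (toUField (fun b => U' b * U₀ b)) →
      Hyp135T P k α₁ (toUField U₀) (toUField U') →
      ∃ u : GaugeTransf P 0 (Matrix.specialUnitaryGroup (Fin N) ℂ),
        (Restr129T P k (toUField U₀) (toUGauge P N u) ∧
          Concl2Setup P k η β₀ B₁ B₂ len α₀ α₁ (toUField U₀) (toUField U') (toUGauge P N u)) ∧
        ∀ u' : GaugeTransf P 0 (Matrix.specialUnitaryGroup (Fin N) ℂ),
          Restr129T P k (toUField U₀) (toUGauge P N u') →
          Concl2Setup P k η β₀ B₁ B₂ len α₀ α₁ (toUField U₀) (toUField U') (toUGauge P N u') → u' = u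

variable {P N}

/-- **`Thm2SetupAt` at `G = SU(N)` ⟹ the `SU(N)`-native form**: the `U(N)`-valued gauge transformation with `SU(N)` values IS an
`SU(N)`-valued one (`exists_toUGauge_eq`), and uniqueness transfers along the injection `toUGauge`. [cite: Balaban1985RegularSpaces, Thm 2 p.83] -/
theorem thm2SetupSUAt_of_thm2SetupAt {k : ℕ} {η β₀ B₁ B₂ c₁ : ℝ} {len : LSite P.d → ℝ}
    {Reg : (LSite P.d → Fin P.d → (Matrix (Fin N) (Fin N) ℂ)ˣ) → Prop}
    (h : Thm2SetupAt P N k η β₀ B₁ B₂ c₁ len (specialUnitaryUnits (Fin N)) Reg) :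
    Thm2SetupSUAt P N k η β₀ B₁ B₂ c₁ len Reg := by
  intro α₀ α₁ hα₀ hα₁ hc U₀ U' h33 hReg h34 h34' h35
  rw [toUField_mul] at h34 h34'
  obtain ⟨v, ⟨hvG, h129, hC⟩, huniq⟩ := h hα₀ hα₁ hc (toUField U₀) (toUField U') (unitsField_toUField_mem U₀)
    (unitsField_toUField_mem U') h33 hReg h34 h34' h35
  obtain ⟨u, rfl⟩ := exists_toUGauge_eq hvG
  exact ⟨u, ⟨h129, hC⟩, fun u' h129' hC' => toUGauge_injective (huniq _ (toUnits_toUGauge_mem u') h129' hC')⟩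

/-- **… hence from `B8Thm2TorusAt.Thm2TorusAt` at the gauge group `specialUnitaryUnits (Fin N)` and the period `sitesPerDir 0`.**
[cite: Balaban1985RegularSpaces, Thm 2 p.83, p.77 («Ω_j = T_η»)] -/
theorem thm2SetupSUAt_of_thm2TorusAt [NeZero N] {k : ℕ} {η β₀ B₁ B₂ c₁ : ℝ} {len : LSite P.d → ℝ}
    {Reg : (LSite P.d → Fin P.d → (Matrix (Fin N) (Fin N) ℂ)ˣ) → Prop}
    (h : Thm2TorusAt P.L k (((P.sitesPerDir 0 : ℕ) : ℤ)) η β₀ B₁ B₂ c₁ len (specialUnitaryUnits (Fin N)) Reg) :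
    Thm2SetupSUAt P N k η β₀ B₁ B₂ c₁ len Reg :=
  thm2SetupSUAt_of_thm2SetupAt (thm2SetupAt_specialUnitary_of_thm2TorusAt h)

end SpecialUnitary

/-! ## §6 Non-vacuity of the hypothesis class at the Setup-torus objects -/

section NonVacuity

open scoped Matrix.Norms.L2Operator

variable {N : ℕ} [NeZero N]

/-- **For ANY background `U₀` the perturbation `U′ = 1` satisfies (1.34)₂ and (1.35) at the Setup-torus objects** (`1·U₀ = U₀`;
`B8Eq119TwistedAxial.inAx_self`; `B8Thm2TorusAt.hyp135_one_left`). [cite: Balaban1985RegularSpaces, (1.34)–(1.35) p.82, (1.16) p.78] -/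
theorem hypotheses_of_one_right_setup (k : ℕ) {α₁ : ℝ} (hα₁ : 0 < α₁) (U₀ : GaugeField P 0 (Matrix.unitaryGroup (Fin N) ℂ)) :
    InAxT P k U₀ (fun b => (1 : GaugeField P 0 (Matrix.unitaryGroup (Fin N) ℂ)) b * U₀ b) ∧
      Hyp135T P k α₁ U₀ (1 : GaugeField P 0 (Matrix.unitaryGroup (Fin N) ℂ)) := by
  have h1 : cfgPull P (1 : GaugeField P 0 (Matrix.unitaryGroup (Fin N) ℂ)) = 1 := by
    funext z μ; apply Units.ext; rw [cfgPull_apply, val_unitsField]; rfl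
  constructor
  · unfold InAxT
    rw [cfgPull_mul, h1, one_mul]
    exact B8Eq119TwistedAxial.inAx_self P.L k (torusLam k) _
  · unfold Hyp135T
    rw [h1]
    exact B8Thm2TorusAt.hyp135_one_left P.L k (torusLam k) _ hα₁

end NonVacuity

/-! ## §7 The GUARDED uniform form — the period of print's torus is positive and divisible by `L^k` (referee remark R2 on `B8Thm2TorusAt.Thm2TorusUniform`) -/

section Guarded

variable {d : ℕ}
variable {𝔸 : Type*} [NormedRing 𝔸] [StarRing 𝔸] [NormedAlgebra ℂ 𝔸] [CompleteSpace 𝔸]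

/-- **GUARDED UNIFORM FORM of [B8] Theorem 2 at the all-torus members.**  `B8Thm2TorusAt.Thm2TorusUniform` quantifies over EVERY
period `P : ℤ`; at `P = 0` the periodicity binders `shiftCfg (0 • e i) U = U` hold for every configuration, so that form also asserts
Theorem 2 on the whole of `ℤᵈ`, which print (a finite torus `T_η`, p. 77) does not state (referee remark R2, dag-ref-A READ-25, 2026-08-26 —
harmless as a HYPOTHESIS, to be guarded before anyone cites it as a fact).  This is the guarded form: the period is POSITIVE and DIVISIBLE BY
`L^k` (print's torus is a union of `L^k`-cubes: «Ω_j = B^j(Ω_j^{(j)})» (1.4) p. 77, [B7] (4) p. 18 «B^j(Ω^{(j)}) = Ω for j = 1, …, k …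
Thus Ω is a sum of blocks of the order k»), one triple `(B₁, B₂(β₀), c₁)` serving every `k ≥ 1`, every such period and every `η > 0`.  It FOLLOWS from the unguarded form (`guarded_of_uniform`) and it suffices for
the Setup-torus objects (`thm2SetupAt_of_uniformGuarded`: the Setup period `sitesPerDir 0 = 2·L^{m+K}` is positive and `L^k ∣ 2·L^{m+K}` for
`k ≤ m + K`).  Asserted for nothing. [cite: Balaban1985RegularSpaces, Thm 2 p.83, p.77 («Ω_j = T_η for j = 0,1,…,l, l ≤ k»)]
[cite: Balaban1985Averaging, (4) p.18] -/
def Thm2TorusUniformGuarded (L : ℕ) (β₀ : ℝ) (len : LSite d → ℝ) (G : Subgroup 𝔸ˣ)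
    (Reg : ℕ → ℤ → ℝ → (LSite d → Fin d → 𝔸ˣ) → Prop) : Prop :=
  ∃ B₁ B₂ c₁ : ℝ, 0 < B₁ ∧ 0 < B₂ ∧ 0 < c₁ ∧
    ∀ (k : ℕ) (P : ℤ) (η : ℝ), 1 ≤ k → 0 < P → (L : ℤ) ^ k ∣ P → 0 < η → Thm2TorusAt L k P η β₀ B₁ B₂ c₁ len G (Reg k P η)

/-- The unguarded uniform form implies the guarded one (drop two hypotheses). [cite: Balaban1985RegularSpaces, Thm 2 p.83] -/
theorem guarded_of_uniform {L : ℕ} {β₀ : ℝ} {len : LSite d → ℝ} {G : Subgroup 𝔸ˣ}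
    {Reg : ℕ → ℤ → ℝ → (LSite d → Fin d → 𝔸ˣ) → Prop} (h : B8Thm2TorusAt.Thm2TorusUniform L β₀ len G Reg) :
    Thm2TorusUniformGuarded L β₀ len G Reg := by
  obtain ⟨B₁, B₂, c₁, hB₁, hB₂, hc₁, H⟩ := h
  exact ⟨B₁, B₂, c₁, hB₁, hB₂, hc₁, fun k P η hk _ _ hη => H k P η hk hη⟩

/-- The Setup period `sitesPerDir j = 2·L^{m+K−j}` is positive. [cite: Balaban1987RG1, (0.1) p.251] -/
theorem period_pos (P : Params) (j : ℕ) : 0 < ((P.sitesPerDir j : ℕ) : ℤ) := by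
  exact_mod_cast Nat.pos_of_ne_zero (P.sitesPerDir_ne_zero j)

/-- … and divisible by `L^k` for `k ≤ m + K − j` (the `L^k`-cubes tile the level-`j` torus). [cite: Balaban1987RG1, (0.1) p.251]
[cite: Balaban1985Averaging, (4) p.18] -/
theorem pow_dvd_period (P : Params) {j k : ℕ} (hk : k ≤ P.m + P.K - j) : (P.L : ℤ) ^ k ∣ ((P.sitesPerDir j : ℕ) : ℤ) := by
  unfold Params.sitesPerDir; push_cast; exact Dvd.dvd.mul_left (pow_dvd_pow _ hk) 2

end Guarded

section GuardedSetup

open scoped Matrix.Norms.L2Operator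

variable {N : ℕ} [NeZero N]

/-- **The guarded uniform form suffices at the Setup-torus objects** for the levels `1 ≤ k ≤ m + K` that the Setup torus carries
(`period_pos`, `pow_dvd_period`, `thm2SetupAt_of_thm2TorusAt`). [cite: Balaban1985RegularSpaces, Thm 2 p.83, p.77 («Ω_j = T_η»)] -/
theorem thm2SetupAt_of_uniformGuarded {β₀ : ℝ} {len : LSite P.d → ℝ} {G : Subgroup (Matrix (Fin N) (Fin N) ℂ)ˣ}
    (hG : G ≤ unitaryUnits (Matrix (Fin N) (Fin N) ℂ)) {Reg : ℕ → ℤ → ℝ → (LSite P.d → Fin P.d → (Matrix (Fin N) (Fin N) ℂ)ˣ) → Prop}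
    (h : Thm2TorusUniformGuarded P.L β₀ len G Reg) :
    ∃ B₁ B₂ c₁ : ℝ, 0 < B₁ ∧ 0 < B₂ ∧ 0 < c₁ ∧ ∀ (k : ℕ) (η : ℝ), 1 ≤ k → k ≤ P.m + P.K → 0 < η →
      Thm2SetupAt P N k η β₀ B₁ B₂ c₁ len G (Reg k (((P.sitesPerDir 0 : ℕ) : ℤ)) η) := by
  obtain ⟨B₁, B₂, c₁, hB₁, hB₂, hc₁, H⟩ := h
  refine ⟨B₁, B₂, c₁, hB₁, hB₂, hc₁, fun k η hk hkK hη => thm2SetupAt_of_thm2TorusAt hG (H k _ η hk (period_pos P 0) ?_ hη)⟩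
  exact pow_dvd_period P (j := 0) (by omega)

end GuardedSetup

end Literature.MathematicalPhysics.QuantumFieldTheory.Balaban1983to89.B8Thm2SetupTorus

end
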